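import Summits.ABC.IUTFork.Joshi.LogLinkInsertedIsometry
import Summits.ABC.IUTFork.Joshi.MochizukiAnsatzLocal
import Summits.ABC.IUTFork.Joshi.PrimitiveAnsatzPointsClassical
import Summits.ABC.IUTFork.Joshi.LogLinkTeichmullerFrobeniusModel
import Mathlib.Algebra.MvPolynomial.Variables
import HarnessLib

/-!
# The SHIFTED Witt ring over ANY datum of the [J-IIp] signature: `B := MvPolynomial F (ℤ → K)`, `[a] := X_a`,
# `ϕ := rename (·^p) ∘ map shift` — the Witt law `ϕ([a]) = [a^p]` for free, §10.13 transports wherever the base datum's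
# Teichmüller values are `ϕ`-compatible, `B^{φ=p} ≠ 0`, «log hits 1», and p430819's (R-ϕ) horn at those points (W6⁺ layer)

Test-side support file of the abc-iut cell, block E «type Joshi's construction, test vs S» (rung LADDER-ABC:A2.E; seat abc-iut-E-t52
gen 4, the `TeichFrobModel` lineage p434703 / p439129 / p445632 / p451035). CONTEXT: the block's VACUITY entry W6 (E-t50 g5, STATUS
2026-08-26T13:07:13Z; boundary theorem p447117) asks for ONE datum of E-t3's `PeriodRingDatum` (`Joshi/ThetaValuesLocus.lean`,
p427971) with E-t2's `EtaPtTeich` (p429331), a bijective point-Frobenius, E-t7's §10.13 `FrobeniusTransport` (p430819) at every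
CLASSICAL point (`classicalPts`, p436515) and the Witt law `ϕ([a]) = [a^p]`; E-t50 g5 builds it (`Joshi/PrototypeWittModel.lean`) on a
polynomial ring with FIXED coefficients, where `B^{φ=p} = 0`. E-t50 13:31:38Z: «the `B^{φ=p} ≠ 0` / KummerShift upgrade on YOUR shifted
ring p445632 stays yours as a sequel». THIS FILE is that sequel, written GENERICALLY so that it waits on no olean: for ANY datum `D₀`
with a constant residue-field family `K_y = K` and ANY index function `ι : Y → ℤ` it builds the datum `WittShift.datum D₀ ι` on
p445632's shifted ring with `D₀`'s points, absolute values, `pt`, `ϕ_Y`, scales UNCHANGED and the Teichmüller VALUES of `D₀`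
re-used as the variable assignment (`η_y(X_x) := η⁰_y([x]⁰)`), and proves — over two explicit per-point hypotheses
(H1) `η⁰_{ϕy}([x^p]⁰) = η⁰_y([x]⁰)` for all `x` («the base datum's Teichmüller values are `ϕ`-compatible at `y`», which under a
§10.13 transport with identity residue map IS the Witt law read in `K`) and (H2) `ι(ϕy) + 1 = ι(y)` — everything the lineage typed
on the (R-ϕ) side, at `y`. Source of the hypotheses: K. Joshi, arXiv:2303.01662v3 §6.6, §6.10, §10.5, §10.13–§10.15
(`paper:arxiv-2303.01662`, bib `Joshi2023ATS2Local`, UNREFEREED — typed AS A CANDIDATE by E-t3/E-t7/E-t2; nothing of it asserted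
here). TAKES NO SIDE on [IUTchIII] Cor. 3.12, on Joshi's claims, or on Mochizuki's reports on them; a model exhibits satisfiability of
TYPED hypotheses, nothing more; typed ≠ proved.

WHAT IS PROVED (all over binders; `D := WittShift.datum D₀ ι`).
* §1–§2 the ring (`TeichFrobModel`'s construction with coefficients in `K` and the norm read through `|·|_F`): `frobHom_X`
  (`ϕ(X_a) = X_{a^p}`), `frobHom_C`, ultrametric `vnorm` with `|X_a| = |a|_F`, `B⁺` `ϕ`-stable; the datum `datum D₀ ι` (all fields;
  `T_y := {0}`, Galois trivial on `B`).
* §3 **`frob_teich`** (the Witt law, unconditionally); `classicalPts_eq : D.classicalPts = D₀.classicalPts` and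
  **`etaPtTeich_iff : D.EtaPtTeich ↔ D₀.EtaPtTeich`** (both `rfl`-level: same `pt`, `|·|_F`, and `η_y(X_a) = η⁰_y([a]⁰)`); `frobY`/`pt`
  are `D₀`'s, so a bijective `ϕ_Y` is inherited verbatim.
* §4 under (H1)+(H2) at `y`: `eta_comp_frob : η_{ϕy} ∘ ϕ = η_y` as ring maps, hence **`transport : D.FrobeniusTransport y`** (kernel
  form trivially, both `η` onto through constants) with `residueIso = id` (`residueIso_apply`), the identity `CommonTarget`
  `FrobCompatible`; `B^{φ=p} ∋ eig n := C(m ↦ p^{m−n}) ≠ 0` (`eig_mem_Bphi`, `eig_ne_zero`; `(p : K) ≠ 0, ≠ 1` DERIVED from the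
  signature at the point `pt 0`, `natCast_p_ne_zero/one`), «log hits 1» at `ϕy` (`hone`), `KummerShift` (trivially); whence BY NAME
  p430819's horn **`rphi_horn`**: `¬NoCommutingFieldIso y ∧ ¬NoInsertedIso ∧ LogShellStep ∧ ¬LogsCoincide`, and p437232 §1
  **`scale_frobY`**: `scale(ϕy) = p·scale(y)` — a CHECK any base datum offering (H1) at `y` must pass.
* §5 **`package`**: for a set `C` of points carrying (H1)+(H2): Witt law ∧ transports on `C` ∧ `KummerShift` ∧ `B^{φ=p} ≠ 0` ∧ horn on
  `C` ∧ (`D₀.EtaPtTeich → D.EtaPtTeich`) ∧ `classicalPts` unchanged. With E-t50's W6 datum as `D₀` and `C = classicalPts` this is W6⁺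
  (sequel instance, one `exact`, once that file lands).
* §6 NON-VACUITY of (H1)+(H2) TODAY: at the lineage's own `TeichFrobModel.datum p` (p445632) with `ι := TeichFrobModel.idx` they hold at
  every column point `n+1` (`(x^p)^{p^n} = x^{p^{n+1}}`), `selftest_transport`.
[folklore] algebra throughout; no claim about Joshi's or Mochizuki's mathematics is made or implied.
-/

noncomputable section

open MvPolynomial

namespace Summit.ABC.IUTFork.Joshi.WittShift

variable {F B₀ E0 Y K G : Type} [Field F] [CommRing B₀] [Field E0] [Field K]
  (D₀ : PeriodRingDatum F B₀ E0 Y (fun _ => K) G) (ι : Y → ℤ)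

/-! ## 1. The shifted Witt ring over `K` -/

/-- Coefficients: functions on a `ℤ`-indexed column with values in the common residue field `K`. [folklore] -/
abbrev Coef (K : Type) : Type := ℤ → K

/-- The ring `B := MvPolynomial F (ℤ → K)`: one variable `X_a` = formal Teichmüller `[a]` per `a ∈ F`. [folklore] -/
abbrev Ring (F K : Type) [Field K] : Type := MvPolynomial F (Coef K)

/-- The coefficient shift `(shift c)(m) = c(m+1)`. [folklore] -/
def shiftHom : Coef K →+* Coef K where
  toFun c m := c (m + 1)
  map_one' := rfl
  map_mul' _ _ := rfl
  map_zero' := rfl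
  map_add' _ _ := rfl

/-- `(shift c)(m) = c(m+1)`. [folklore] -/
@[simp] theorem shiftHom_apply (c : Coef K) (m : ℤ) : shiftHom c m = c (m + 1) := rfl

/-- **`ϕ := rename (a ↦ a^p) ∘ map shift`**, a ring endomorphism of `B`. [folklore] -/
def frobHom : Ring F K →+* Ring F K :=
  (rename fun a : F => a ^ D₀.p).toRingHom.comp (MvPolynomial.map (shiftHom (K := K)))

/-- `ϕ(X_a) = X_{a^p}` — the Witt–Teichmüller law by construction. [folklore] -/
theorem frobHom_X (a : F) : frobHom D₀ (X a : Ring F K) = X (a ^ D₀.p) := by simp [frobHom, map_X, rename_X]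

/-- `ϕ(C c) = C(shift c)`. [folklore] -/
theorem frobHom_C (c : Coef K) : frobHom D₀ (C c : Ring F K) = C (shiftHom c) := by simp [frobHom, map_C]

/-- The norm `|f| := max |a|_F` over the variables `X_a` occurring in `f` (`0` if none). [folklore] -/
def vnorm (f : Ring F K) : ℝ := ((f.vars.sup fun a => (D₀.absF a).toNNReal : NNReal) : ℝ)

/-- `|f| ≥ 0`. [folklore] -/
theorem vnorm_nonneg (f : Ring F K) : 0 ≤ vnorm D₀ f := NNReal.coe_nonneg _

/-- Ultrametricity `|f + g| ≤ max(|f|, |g|)`. [folklore] -/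
theorem vnorm_add (f g : Ring F K) : vnorm D₀ (f + g) ≤ max (vnorm D₀ f) (vnorm D₀ g) := by
  classical
  simp only [vnorm, ← NNReal.coe_max, NNReal.coe_le_coe]
  exact (Finset.sup_mono (vars_add_subset f g)).trans (le_of_eq Finset.sup_union)

/-- `|X_a| = |a|_F`. [folklore] -/
theorem vnorm_X (a : F) : vnorm D₀ (X a : Ring F K) = D₀.absF a := by
  simp [vnorm, vars_X, Real.coe_toNNReal _ ((D₀.absF).nonneg a)]

/-- `|0| ≤ 1`. [folklore] -/
theorem vnorm_zero_le : vnorm D₀ (0 : Ring F K) ≤ 1 := by simp [vnorm, vars_0]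

/-- `B⁺ = {|f| ≤ 1}` is `ϕ`-stable (variables of `ϕ f` are `p`-th powers of variables of `f`). [folklore] -/
theorem vnorm_frob_le_one {f : Ring F K} (h : vnorm D₀ f ≤ 1) : vnorm D₀ (frobHom D₀ f) ≤ 1 := by
  classical
  simp only [vnorm, ← NNReal.coe_one, NNReal.coe_le_coe] at h ⊢
  refine Finset.sup_le fun b hb => ?_
  obtain ⟨a, ha, rfl⟩ := Finset.mem_image.1 (vars_rename _ _ hb)
  have ha' : (D₀.absF a).toNNReal ≤ 1 := (Finset.le_sup (f := fun a => (D₀.absF a).toNNReal) (vars_map _ _ ha)).trans h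
  rw [map_pow, Real.toNNReal_pow ((D₀.absF).nonneg a)]
  exact pow_le_one₀ zero_le ha'

/-! ## 2. The datum: `D₀`'s points and Teichmüller VALUES, the shifted ring -/

/-- **`η_y : B → K`**: coefficients read at the index `ι y`, `X_x ↦ η⁰_y([x]⁰)` (the base datum's Teichmüller value). [folklore] -/
def etaHom (y : Y) : Ring F K →+* K := eval₂Hom (Pi.evalRingHom (fun _ : ℤ => K) (ι y)) fun x => D₀.eta y (D₀.teich x)

/-- `η_y(X_x) = η⁰_y([x]⁰)`. [folklore] -/
@[simp] theorem etaHom_X (y : Y) (x : F) : etaHom D₀ ι y (X x) = D₀.eta y (D₀.teich x) := by simp [etaHom]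

/-- `η_y(C c) = c(ι y)`. [folklore] -/
@[simp] theorem etaHom_C (y : Y) (c : Coef K) : etaHom D₀ ι y (C c) = c (ι y) := by simp [etaHom]

/-- **The shifted Witt datum over `D₀`** (points, `|·|`'s, `pt`, `ϕ_Y`, Galois-on-points, `Ē`, scales = `D₀`'s; ring, norm, `[·]`, `ϕ`,
`η` as above; `T_y := {0}`; Galois acts trivially on `B`). [folklore] -/
def datum : PeriodRingDatum F (Ring F K) E0 Y (fun _ => K) G where
  p := D₀.p
  p_prime := D₀.p_prime
  absF := D₀.absF
  norm _ := vnorm D₀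
  norm_nonneg _ := vnorm_nonneg D₀
  norm_add_le _ := vnorm_add D₀
  teich := X
  norm_teich _ x _ _ := vnorm_X D₀ x
  gal _ := id
  frob := frobHom D₀
  gal_norm_one _ _ h := h
  frob_norm_one _ h := vnorm_frob_le_one D₀ h
  absK := D₀.absK
  eta := etaHom D₀ ι
  absK_eta_teich y x := by rw [etaHom_X]; exact D₀.absK_eta_teich y x
  exists_teich_lift y ξ hξ := by
    obtain ⟨x, hx⟩ := D₀.exists_teich_lift y ξ hξ
    exact ⟨x, by rw [etaHom_X]; exact hx⟩
  T _ := {0}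
  zero_mem_T _ := rfl
  eta_T _ τ hτ := by rw [Set.mem_singleton_iff.1 hτ, map_zero]
  T_norm_one _ τ hτ := by rw [Set.mem_singleton_iff.1 hτ]; exact vnorm_zero_le D₀
  pt := D₀.pt
  frobY := D₀.frobY
  pt_frob := D₀.pt_frob
  galF := D₀.galF
  absF_galF := D₀.absF_galF
  galY := D₀.galY
  pt_gal := D₀.pt_gal
  abs0 := D₀.abs0
  abs0_p := D₀.abs0_p
  emb := D₀.emb
  scale := D₀.scale
  scale_pos := D₀.scale_pos
  absK_emb := D₀.absK_emb
  absK_pt := D₀.absK_pt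

/-! ## 3. The Witt law; classical points and `EtaPtTeich` are the base datum's -/

/-- **The Witt–Teichmüller law `ϕ([a]) = [a^p]`**, unconditionally. [folklore] -/
theorem frob_teich (a : F) : (datum D₀ ι).frob ((datum D₀ ι).teich a) = (datum D₀ ι).teich (a ^ (datum D₀ ι).p) :=
  frobHom_X D₀ a

/-- Same `pt`, same `|·|_F`: the classical points are `D₀`'s. [folklore] -/
theorem classicalPts_eq : (datum D₀ ι).classicalPts = D₀.classicalPts := rfl

/-- `η_y(X_a) = η⁰_y([a]⁰)`: E-t2's `EtaPtTeich` holds for the shifted datum iff it holds for `D₀`. [folklore] -/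
theorem etaPtTeich_iff : (datum D₀ ι).EtaPtTeich ↔ D₀.EtaPtTeich := by
  unfold PeriodRingDatum.EtaPtTeich
  simp only [show (datum D₀ ι).eta = etaHom D₀ ι from rfl, show (datum D₀ ι).teich = X from rfl, etaHom_X]
  exact Iff.rfl

/-- `(p : K) ≠ 0` — DERIVED from the signature (`|p|_{K_y} = |p|_0^{scale y} > 0` at the point `pt 0`). [folklore] -/
theorem natCast_p_ne_zero : (D₀.p : K) ≠ 0 := fun h => by
  have h1 := D₀.absK_natCast_p (D₀.pt 0)
  rw [h, map_zero] at h1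
  exact (Real.rpow_pos_of_pos D₀.abs0_p.1 _).ne h1

/-- `(p : K) ≠ 1` — DERIVED (`|p|_{K_y} = |p|_0^{scale y} < 1`). [folklore] -/
theorem natCast_p_ne_one : (D₀.p : K) ≠ 1 := fun h => by
  have h1 := D₀.absK_natCast_p (D₀.pt 0)
  rw [h, map_one] at h1
  exact (Real.rpow_lt_one (D₀.abs0.nonneg _) D₀.abs0_p.2 (D₀.scale_pos _)).ne' h1

/-! ## 4. Transports, `B^{φ=p} ≠ 0`, «log hits 1», the (R-ϕ) horn — at a point with (H1)+(H2) -/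

/-- The identity identifications `K_y = K_{ϕy} = K` as a `CommonTarget` (§10.14). [folklore] -/
def idTarget (y : Y) : (datum D₀ ι).CommonTarget K y := ⟨RingEquiv.refl _, RingEquiv.refl _⟩

section AtPoint

variable {D₀ ι} {y : Y} (hι : ι (D₀.frobY y) + 1 = ι y)
  (hL : ∀ x : F, D₀.eta (D₀.frobY y) (D₀.teich (x ^ D₀.p)) = D₀.eta y (D₀.teich x))

include hι hL in
/-- KEY IDENTITY under (H1)+(H2): `η_{ϕy} ∘ ϕ = η_y` as ring maps (coefficients: `ev_{ι(ϕy)} ∘ shift = ev_{ι y}`; variables: (H1)).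
[folklore] -/
theorem eta_comp_frob : (etaHom D₀ ι (D₀.frobY y)).comp (frobHom D₀) = etaHom D₀ ι y := by
  refine ringHom_ext (fun c => ?_) (fun x => ?_)
  · simp [frobHom_C, hι]
  · simp [frobHom_X, hL x]

/-- **§10.13's `FrobeniusTransport` at `y`** under (H1)+(H2): both `η` onto through constants, equal maps ⇒ equal kernels. [folklore] -/
def transport : (datum D₀ ι).FrobeniusTransport y where
  frobHom := frobHom D₀
  frobHom_eq _ := rfl
  eta_surj c := ⟨C (Function.const ℤ c), by show etaHom D₀ ι _ _ = c; simp⟩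
  eta_frob_surj c := ⟨C (Function.const ℤ c), by show etaHom D₀ ι (D₀.frobY y) (frobHom D₀ _) = c; simp [frobHom_C]⟩
  ker_eq := by
    show RingHom.ker ((etaHom D₀ ι (D₀.frobY y)).comp (frobHom D₀)) = RingHom.ker (etaHom D₀ ι y)
    rw [eta_comp_frob hι hL]

/-- The Frobenius residue isomorphism `σ_y` is the identity of `K` here. [folklore] -/
theorem residueIso_apply (ξ : K) : (transport hι hL).residueIso ξ = ξ := by
  obtain ⟨b, rfl⟩ := (transport hι hL).eta_surj ξ
  rw [(transport hι hL).residueIso_eta]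
  exact congrArg (fun f : Ring F K →+* K => f b) (eta_comp_frob hι hL)

/-- … which are `FrobCompatible` (reading (R-ϕ) of p430819). [folklore] -/
theorem frobCompatible : PeriodRingDatum.FrobCompatible (transport hι hL) (idTarget D₀ ι y) := fun ξ => residueIso_apply hι hL ξ

end AtPoint

/-- The `ϕ`-eigenconstant `c_n := C(m ↦ p^{m−n})`. [folklore] -/
def eig (n : ℤ) : Ring F K := C fun m : ℤ => (D₀.p : K) ^ (m - n)

/-- `c_n ∈ B^{φ=p}` (`shift(m ↦ p^{m−n}) = p·(m ↦ p^{m−n})`, `p ≠ 0` in `K`). [folklore] -/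
theorem eig_mem_Bphi (n : ℤ) : eig D₀ n ∈ (datum D₀ ι).Bphi := by
  show frobHom D₀ (eig D₀ n) = ((D₀.p : ℕ) : Ring F K) * eig D₀ n
  rw [eig, frobHom_C, ← map_natCast (C : Coef K →+* Ring F K) D₀.p, ← map_mul]
  congr 1
  funext m
  simp only [shiftHom_apply, Pi.mul_apply, Pi.natCast_apply]
  rw [show m + 1 - n = m - n + 1 by ring, zpow_add_one₀ (natCast_p_ne_zero D₀), mul_comm]

/-- `c_n ≠ 0` (its coefficient at `n` is `p^0 = 1`). [folklore] -/
theorem eig_ne_zero (n : ℤ) : eig D₀ n ≠ (0 : Ring F K) := fun h => by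
  have h1 := congr_fun ((C_eq_zero).1 h) n
  simp only [sub_self, zpow_zero, Pi.zero_apply] at h1
  exact one_ne_zero h1

/-- `B^{φ=p} ≠ 0` for the shifted datum. [folklore] -/
theorem exists_mem_Bphi_ne_zero : ∃ b ∈ (datum D₀ ι).Bphi, b ≠ 0 := ⟨eig D₀ 0, eig_mem_Bphi D₀ ι 0, eig_ne_zero D₀ 0⟩

/-- **«log hits 1»** at `ϕ(y)`: `η_{ϕy}(c_{ι(ϕy)}) = p^0 = 1` (no hypothesis needed). [folklore] -/
theorem hone (y : Y) : ∃ b ∈ (datum D₀ ι).Bphi, (datum D₀ ι).eta ((datum D₀ ι).frobY y) b = 1 :=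
  ⟨eig D₀ (ι (D₀.frobY y)), eig_mem_Bphi D₀ ι _, by show etaHom D₀ ι (D₀.frobY y) (eig D₀ _) = 1; simp [eig]⟩

/-- `KummerShift` (E-t3, Thm. 10.20.1 (1)(2) reading) holds — trivially, `T_y = {0}`. [folklore] -/
theorem kummerShift : (datum D₀ ι).KummerShift :=
  ⟨fun _ τ hτ => by
    rw [Set.mem_singleton_iff.1 hτ]; show frobHom D₀ 0 = ((D₀.p : ℕ) : Ring F K) * 0; rw [map_zero, mul_zero],
   fun _ τ hτ => by
    rw [Set.mem_singleton_iff.1 hτ]; show frobHom D₀ 0 ∈ ({0} : Set (Ring F K)); rw [map_zero]; rfl⟩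

section AtPoint

variable {D₀ ι} {y : Y} (hι : ι (D₀.frobY y) + 1 = ι y)
  (hL : ∀ x : F, D₀.eta (D₀.frobY y) (D₀.teich (x ^ D₀.p)) = D₀.eta y (D₀.teich x))

include hι hL in
/-- **p430819's (R-ϕ) horn at `y`** under (H1)+(H2), BY NAME: E-t3's as-printed `NoCommutingFieldIso` fails, the common-target form of
Thm. 10.15.1 (3) fails, (4) `LogShellStep` holds, and reading (R-fix) `LogsCoincide` is refuted (log hits `1`, `p ≠ 1` in `K`). [folklore] -/
theorem rphi_horn :
    ¬ (datum D₀ ι).NoCommutingFieldIso y ∧ ¬ PeriodRingDatum.NoInsertedIso (idTarget D₀ ι y) ∧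
      PeriodRingDatum.LogShellStep (idTarget D₀ ι y) ∧ ¬ PeriodRingDatum.LogsCoincide (idTarget D₀ ι y) :=
  ⟨(datum D₀ ι).not_noCommutingFieldIso_of_transport (transport hι hL),
    PeriodRingDatum.not_noInsertedIso_of_frobCompatible (transport hι hL) _ (frobCompatible hι hL),
    PeriodRingDatum.logShellStep_of_frobCompatible (transport hι hL) _ (frobCompatible hι hL),
    fun h => PeriodRingDatum.logsCoincide_frobCompatible_absurd (transport hι hL) _ (frobCompatible hι hL) h (hone D₀ ι y)
      (natCast_p_ne_one D₀)⟩

include hι hL in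
/-- **p437232 §1 at `y`** (a CHECK on the base datum): (H1)+(H2) force `scale(ϕy) = p · scale(y)` for `D₀`'s own scales, and
`|ξ|_{K_{ϕy}} = |ξ|^p_{K_y}` for `D₀`'s own absolute values (`σ_y = id`). [folklore] -/
theorem scale_frobY_and_absK (ξ : K) :
    D₀.scale (D₀.frobY y) = D₀.p * D₀.scale y ∧ D₀.absK (D₀.frobY y) ξ = D₀.absK y ξ ^ D₀.p := by
  have h₁ := PeriodRingDatum.scale_frobY_of_transport (transport hι hL) (frob_teich D₀ ι)
  have h₂ := PeriodRingDatum.absK_residueIso (transport hι hL) (frob_teich D₀ ι) ξ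
  rw [residueIso_apply] at h₂
  exact ⟨h₁, h₂⟩

end AtPoint

/-! ## 5. The package over a set of points carrying (H1)+(H2) -/

/-- **W6⁺ LAYER.** For a set `C` of points at which the base datum's Teichmüller values are `ϕ`-compatible (H1) and the index steps
(H2): ONE structure with the Witt law, §10.13 transports on `C`, `KummerShift`, `B^{φ=p} ≠ 0`, and at every `y ∈ C` «log hits 1» +
the (R-ϕ) horn; `EtaPtTeich` and `classicalPts` are inherited from `D₀`. [folklore] -/
theorem package (C : Set Y) (hι : ∀ y ∈ C, ι (D₀.frobY y) + 1 = ι y)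
    (hL : ∀ y ∈ C, ∀ x : F, D₀.eta (D₀.frobY y) (D₀.teich (x ^ D₀.p)) = D₀.eta y (D₀.teich x)) :
    (∀ a : F, (datum D₀ ι).frob ((datum D₀ ι).teich a) = (datum D₀ ι).teich (a ^ (datum D₀ ι).p)) ∧
      (∀ y ∈ C, Nonempty ((datum D₀ ι).FrobeniusTransport y)) ∧ (datum D₀ ι).KummerShift ∧
      (∃ b ∈ (datum D₀ ι).Bphi, b ≠ 0) ∧
      (∀ y ∈ C, (∃ b ∈ (datum D₀ ι).Bphi, (datum D₀ ι).eta ((datum D₀ ι).frobY y) b = 1) ∧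
        ¬ (datum D₀ ι).NoCommutingFieldIso y ∧ ¬ PeriodRingDatum.NoInsertedIso (idTarget D₀ ι y) ∧
        PeriodRingDatum.LogShellStep (idTarget D₀ ι y) ∧ ¬ PeriodRingDatum.LogsCoincide (idTarget D₀ ι y)) ∧
      (D₀.EtaPtTeich → (datum D₀ ι).EtaPtTeich) ∧ (datum D₀ ι).classicalPts = D₀.classicalPts :=
  ⟨frob_teich D₀ ι, fun y hy => ⟨transport (hι y hy) (hL y hy)⟩, kummerShift D₀ ι, exists_mem_Bphi_ne_zero D₀ ι,
    fun y hy => ⟨hone D₀ ι y, rphi_horn (hι y hy) (hL y hy)⟩, (etaPtTeich_iff D₀ ι).2, classicalPts_eq D₀ ι⟩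

/-! ## 6. (H1)+(H2) are inhabited today: the lineage's own `TeichFrobModel.datum` at every column point -/

/-- At p445632's `TeichFrobModel.datum p` (constant residue family `Q̄_p`) with `ι := TeichFrobModel.idx`: (H2) `idx n + 1 = idx (n+1)` and
(H1) `(x^p)^{p^n} = x^{p^{n+1}}` hold at the column point `n+1`, so the shifted datum over it transports there — (H1)+(H2) are not
vacuous. (The W6 instance proper is E-t50's datum, sequel.) [folklore] -/
def selftest_transport (p : ℕ) [Fact p.Prime] (n : ℕ) :
    (datum (TeichFrobModel.datum p) (TeichFrobModel.idx p)).FrobeniusTransport (Sum.inr (n + 1)) :=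
  transport (y := (Sum.inr (n + 1) : TeichFrobModel.Pt p)) (by rfl) fun x => by
    show TeichFrobModel.etaHom p (Sum.inr n) (X (x ^ p)) = TeichFrobModel.etaHom p (Sum.inr (n + 1)) (X x)
    simp [TeichFrobModel.etaHom, TeichFrobModel.untilt, pow_succ', pow_mul]

end Summit.ABC.IUTFork.Joshi.WittShift

end
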